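import Summits.CriticalPhenomena.PercolationContinuityZ3.Theses.PercLongRangeCatalyst
import Literature.Probability.Percolation.LongRangeKernelPercolation
import Literature.Probability.Percolation.CriticalContinuityProofs
import Literature.Probability.Percolation.LongRangeVolumeTailBootstrap
import Literature.Probability.LatticeModels.ProdBernoulliCoupling
import Literature.Probability.LatticeModels.IsoradialPercolationProofs

/-!
# Crux-strategist workfile for `UniformCatalystVolumeTail` (stmt-CriticalPhenomena-10383):
# the typed decomposition Δ1 ("unmasking"), its assembly, and its converse — all sorry-free

`U = UniformCatalystVolumeTail` (λ-uniform critical volume tail of the catalyst family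
`J_{λ,α} = 1{nn} + λ‖x−y‖_∞^{−3−α}` on `ℤ³`, route `PercLongRangeCatalyst`).  Pieces:

* `SRSubcritVolumeTail` (P1, OPEN): uniform power-law volume tail of nearest-neighbour bond
  percolation on `ℤ³` below `p_c` — the bare short-range statement.
* `EntropicCatalystInsertion` (P2, theorem-level): generalised Dewan–Muirhead / Hutchcroft
  (J. Stat. Phys. 189 (2022), arXiv:2106.06400, Thm 4.1 + proof of Thm 1.3) run between the kernels
  `λ = 0` and `λ > 0` at the same `b`: `P_{b,λ}(|K|≥n) ≤ 2 P_{p(b)}(|C|≥n) + K bλ Σ_{k≤n} P_{p(b)}(|C|≥k)`,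
  `p(b) = 1 − e^{−b}` (n.n. single-kernel version proved in `HutchcroftVolumeTail.lean`).
* `PerLambdaCatalystVolumeTail` (P3, theorem-level modulo the named fact
  `Hutchcroft2022_twoPoint_volumeTail`, Cor 1.4 with `c = λ`): `P_{b,λ}(|K|≥n) ≤ A λ^{−3/(6−α)} n^{−(3−α)/6}`
  for non-percolating `b ≥ b₀`.
* `SmallBetaCatalystTail` (P4, theorem-level): `b ≤ b₀(α)` is uniformly subcritical (Galton–Watson / path counting).
* `NonPercolatingBelowCritical` (P5, theorem-level): non-percolating `(b,λ)`, `λ>0` ⇒ `1−e^{−b} < p_c(ℤ³)`.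

Results (lean check rc 0, 0 sorries, axioms {propext, Classical.choice, Quot.sound}):
* `uniformCatalystVolumeTail_of : P1 → P2 → P3 → P4 → P5 → U` — the assembly (crossover bookkeeping:
  `α := a'/2` with `a' = min a 1/2`; scales `n ≤ λ^{−1/(1−α)}` by P2+P1 (pointwise and summed,
  `Σ_{k≤n} k^{−a'} ≤ 3n^{1−a'}`), scales `n > λ^{−1/(1−α)}` by P3 using
  `(3−α)/6 − 3(1−α)/(6−α) = (9α+α²)/(6(6−α)) > 0`; `b ≤ b₀` by P4; `b ≤ log 64` from P5 and `p_c ≤ 63/64`).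
* `srSubcritVolumeTail_of : U → SubcritCatalystStability → P1` — the converse (monotone coupling).
Hence `U ≡ P1` modulo the theorem-level statements {SubcritCatalystStability (stmt-4824), P2, P3, P4, P5}:
the deciding crux of the route is the short-range subcritical volume-tail bound with the catalyst removed.
See `STRATEGY-CENSUS.md` in this directory for the verdict (no-decomposition) and Δ2–Δ10.
-/

noncomputable section

namespace Summit.CriticalPhenomena.PercolationContinuityZ3.Cruxes.UniformCatalystVolumeTail.Unmask

open MeasureTheory Literature.Probability.LatticeModels Literature.Probability.Percolation
open Summit.CriticalPhenomena.PercolationContinuityZ3.Theses.PercLongRangeCatalyst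

/-- The catalyst kernel `J_{λ,α}(e) = 1{e ∈ E(ℤ³)} + λ · dist^{−(3+α)}` (route's inline shape). -/
def catalystKernel (l α : ℝ) (e : Sym2 (Site 3)) : ℝ :=
  (if e ∈ (zdGraph 3).edgeSet then (1:ℝ) else 0) +
    l * (Sym2.lift ⟨fun x y : Site 3 => (dist x y : ℝ), fun x y => dist_comm x y⟩ e) ^ (-(3 + α))

/-- The catalyst law `P_{b,λ} = kernelPercolation J_{λ,α} b`. -/
def catalystLaw (α l b : ℝ) : Measure (BondConfig (Site 3)) :=
  kernelPercolation (catalystKernel l α) b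

/-- The route's inline measure is `catalystLaw α l b` (definitional). -/
theorem catalystLaw_eq (α l b : ℝ) :
    catalystLaw α l b =
      prodBernoulli (fun e : Sym2 (Site 3) => Set.projIcc (0:ℝ) 1 zero_le_one
        (1 - Real.exp (-(b * ((if e ∈ (zdGraph 3).edgeSet then (1:ℝ) else 0) +
          l * (Sym2.lift ⟨fun x y : Site 3 => (dist x y : ℝ), fun x y => dist_comm x y⟩ e) ^ (-(3 + α))))))) :=
  rfl

/-- The route's inline event is `clusterSizeGe 0 n` (definitional). -/
theorem event_eq (n : ℕ) :
    ({ω : BondConfig (Site 3) | ((n : ℕ) : ℕ∞) ≤ (openCluster ω (0 : Site 3)).encard} :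
      Set (BondConfig (Site 3))) = clusterSizeGe (0 : Site 3) n :=
  rfl

/-- **P1 (open).** Uniform subcritical volume tail of nearest-neighbour bond percolation on `ℤ³`:
`∃ a > 0, C` with `P_p(|C(0)| ≥ n) ≤ C n^{−a}` for all `p < p_c(ℤ³)` and `n ≥ 1`. -/
def SRSubcritVolumeTail : Prop :=
  ∃ a C : ℝ, 0 < a ∧ ∀ p : unitInterval, (p : ℝ) < criticalProb (zdGraph 3) (0 : Site 3) →
    ∀ n : ℕ, 1 ≤ n →
      (bondPercolation (zdGraph 3) p).real (clusterSizeGe (0 : Site 3) n) ≤ C * (n : ℝ) ^ (-a)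

/-- **P2 (theorem-level).** Entropic catalyst insertion (generalised Dewan–Muirhead between the
kernels `λ = 0` and `λ`, same `b`). -/
def EntropicCatalystInsertion : Prop :=
  ∀ α : ℝ, 0 < α → ∃ K : ℝ, 0 ≤ K ∧ ∀ l : ℝ, 0 < l → l ≤ 1 → ∀ b : ℝ, 0 < b →
    ∀ p : unitInterval, (p : ℝ) = 1 - Real.exp (-b) → ∀ n : ℕ, 1 ≤ n →
      (catalystLaw α l b).real (clusterSizeGe (0 : Site 3) n) ≤
        2 * (bondPercolation (zdGraph 3) p).real (clusterSizeGe (0 : Site 3) n) +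
          K * b * l * ∑ k ∈ Finset.Icc 1 n,
            (bondPercolation (zdGraph 3) p).real (clusterSizeGe (0 : Site 3) k)

/-- **P3 (theorem-level modulo `Hutchcroft2022_twoPoint_volumeTail`).** Per-λ Hutchcroft Cor 1.4 for
the catalyst family with the `λ^{−3/(6−α)}` amplitude, for non-percolating `b ≥ b₀`. -/
def PerLambdaCatalystVolumeTail : Prop :=
  ∀ α : ℝ, 0 < α → α < 3 → ∀ b₀ : ℝ, 0 < b₀ → ∃ A : ℝ, 0 ≤ A ∧ ∀ l : ℝ, 0 < l → l ≤ 1 →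
    ∀ b : ℝ, b₀ ≤ b → (catalystLaw α l b).real (percolatesAt (0 : Site 3)) = 0 → ∀ n : ℕ, 1 ≤ n →
      (catalystLaw α l b).real (clusterSizeGe (0 : Site 3) n) ≤
        A * l ^ (-(3 / (6 - α))) * (n : ℝ) ^ (-((3 - α) / 6))

/-- **P4 (theorem-level).** Small-`b` regime: `b ≤ b₀(α)` is uniformly subcritical in `λ ≤ 1`. -/
def SmallBetaCatalystTail : Prop :=
  ∀ α : ℝ, 0 < α → ∃ b₀ : ℝ, 0 < b₀ ∧ ∃ C a : ℝ, 0 < a ∧ ∀ l : ℝ, 0 < l → l ≤ 1 →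
    ∀ b : ℝ, 0 < b → b ≤ b₀ → ∀ n : ℕ, 1 ≤ n →
      (catalystLaw α l b).real (clusterSizeGe (0 : Site 3) n) ≤ C * (n : ℝ) ^ (-a)

/-- **P5 (theorem-level).** A non-percolating catalyst model (`λ > 0`) has nearest-neighbour
density strictly below `p_c(ℤ³)`. -/
def NonPercolatingBelowCritical : Prop :=
  ∀ α : ℝ, 0 < α → ∀ l : ℝ, 0 < l → l ≤ 1 → ∀ b : ℝ, 0 < b →
    (catalystLaw α l b).real (percolatesAt (0 : Site 3)) = 0 →
      1 - Real.exp (-b) < criticalProb (zdGraph 3) (0 : Site 3)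


/-! ### Elementary helpers (sums of powers, the crossover exponent) -/


/-- Bernoulli step: `(1−a)(k+1)^{−a} ≤ (k+1)^{1−a} − k^{1−a}` for `k ≥ 0`, `0 < a < 1`. -/
theorem rpow_step {a : ℝ} (ha0 : 0 < a) (ha1 : a < 1) {k : ℝ} (hk : 0 ≤ k) :
    (1 - a) * (k + 1) ^ (-a) ≤ (k + 1) ^ (1 - a) - k ^ (1 - a) := by
  have ht : 0 < k + 1 := by linarith
  set u : ℝ := k / (k + 1) with hu
  have hu0 : 0 ≤ u := div_nonneg hk ht.le
  have hu1 : u ≤ 1 := by rw [hu, div_le_one ht]; linarith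
  -- Bernoulli: u^{1-a} ≤ 1 + (1-a)(u-1)
  have hB : u ^ (1 - a) ≤ 1 + (1 - a) * (u - 1) := by
    have := rpow_one_add_le_one_add_mul_self (show (-1 : ℝ) ≤ u - 1 by linarith)
      (show (0 : ℝ) ≤ 1 - a by linarith) (show (1 - a : ℝ) ≤ 1 by linarith)
    simpa [add_sub_cancel] using this
  -- multiply by (k+1)^{1-a}
  have hk_eq : k = u * (k + 1) := by rw [hu]; field_simp
  have hpow : k ^ (1 - a) = u ^ (1 - a) * (k + 1) ^ (1 - a) := by
    conv_lhs => rw [hk_eq]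
    exact Real.mul_rpow hu0 ht.le
  have ht1a : 0 < (k + 1) ^ (1 - a) := Real.rpow_pos_of_pos ht _
  have hsplit : (k + 1) ^ (1 - a) = (k + 1) * (k + 1) ^ (-a) := by
    rw [show (1 - a : ℝ) = 1 + (-a) by ring, Real.rpow_add ht, Real.rpow_one]
  have h1u : (1 - u) * (k + 1) = 1 := by rw [hu]; field_simp; ring
  calc (1 - a) * (k + 1) ^ (-a)
      = (1 - a) * ((1 - u) * (k + 1)) * (k + 1) ^ (-a) := by rw [h1u, mul_one]
    _ = (1 - a) * (1 - u) * ((k + 1) * (k + 1) ^ (-a)) := by ring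
    _ = (1 - a) * (1 - u) * (k + 1) ^ (1 - a) := by rw [← hsplit]
    _ = (k + 1) ^ (1 - a) - (1 + (1 - a) * (u - 1)) * (k + 1) ^ (1 - a) := by ring
    _ ≤ (k + 1) ^ (1 - a) - u ^ (1 - a) * (k + 1) ^ (1 - a) := by
        have := mul_le_mul_of_nonneg_right hB ht1a.le
        linarith
    _ = (k + 1) ^ (1 - a) - k ^ (1 - a) := by rw [← hpow]

/-- `Σ_{k=1}^{n} k^{−a} ≤ 1 + (n^{1−a} − 1)/(1−a)` for `n ≥ 1`, `0 < a < 1`. -/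
theorem sum_Icc_rpow_neg_le' {a : ℝ} (ha0 : 0 < a) (ha1 : a < 1) :
    ∀ n : ℕ, 1 ≤ n → ∑ k ∈ Finset.Icc 1 n, (k : ℝ) ^ (-a) ≤ 1 + ((n : ℝ) ^ (1 - a) - 1) / (1 - a) := by
  intro n hn
  induction n with
  | zero => exact absurd hn (by norm_num)
  | succ m ih =>
    rcases Nat.eq_zero_or_pos m with hm | hm
    · subst hm
      simp
    · have ih' := ih hm
      rw [Finset.sum_Icc_succ_top (by omega : 1 ≤ m + 1), ]
      have hstep := rpow_step ha0 ha1 (show (0 : ℝ) ≤ (m : ℝ) by positivity)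
      have h1a : 0 < 1 - a := by linarith
      push_cast
      -- goal: Σ_{Icc 1 m} + (m+1)^{-a} ≤ 1 + ((m+1)^{1-a} - 1)/(1-a)
      have key : ((m : ℝ) + 1) ^ (-a) ≤ (((m : ℝ) + 1) ^ (1 - a) - (m : ℝ) ^ (1 - a)) / (1 - a) := by
        rw [le_div_iff₀ h1a, mul_comm]
        exact hstep
      calc ∑ k ∈ Finset.Icc 1 m, (k : ℝ) ^ (-a) + ((m : ℝ) + 1) ^ (-a)
          ≤ (1 + ((m : ℝ) ^ (1 - a) - 1) / (1 - a)) + (((m : ℝ) + 1) ^ (1 - a) - (m : ℝ) ^ (1 - a)) / (1 - a) :=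
            add_le_add ih' key
        _ = 1 + (((m : ℝ) + 1) ^ (1 - a) - 1) / (1 - a) := by
            field_simp
            ring

/-- `Σ_{k=1}^{n} k^{−a} ≤ 3 n^{1−a}` for `n ≥ 1`, `0 < a ≤ 1/2`. -/
theorem sum_Icc_rpow_neg_le {a : ℝ} (ha0 : 0 < a) (ha1 : a ≤ 1 / 2) (n : ℕ) (hn : 1 ≤ n) :
    ∑ k ∈ Finset.Icc 1 n, (k : ℝ) ^ (-a) ≤ 3 * (n : ℝ) ^ (1 - a) := by
  have ha1' : a < 1 := by linarith
  have h := sum_Icc_rpow_neg_le' ha0 ha1' n hn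
  have hn1 : (1 : ℝ) ≤ n := by exact_mod_cast hn
  have hpow1 : (1 : ℝ) ≤ (n : ℝ) ^ (1 - a) := Real.one_le_rpow hn1 (by linarith)
  have h1a : (0 : ℝ) < 1 - a := by linarith
  have h1a2 : 1 / (1 - a) ≤ 2 := by
    rw [div_le_iff₀ h1a]; linarith
  calc ∑ k ∈ Finset.Icc 1 n, (k : ℝ) ^ (-a) ≤ 1 + ((n : ℝ) ^ (1 - a) - 1) / (1 - a) := h
    _ = 1 + (1 / (1 - a)) * ((n : ℝ) ^ (1 - a) - 1) := by ring
    _ ≤ (n : ℝ) ^ (1 - a) + 2 * ((n : ℝ) ^ (1 - a) - 1) := by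
        have : 0 ≤ (n : ℝ) ^ (1 - a) - 1 := by linarith
        nlinarith
    _ ≤ 3 * (n : ℝ) ^ (1 - a) := by linarith

/-- Exponent identity for the crossover: `(3−α)/6 − (3/(6−α))(1−α) = (9α+α²)/(6(6−α))`. -/
theorem exponent_identity {α : ℝ} (hα : α < 6) :
    (3 - α) / 6 - 3 / (6 - α) * (1 - α) = (9 * α + α ^ 2) / (6 * (6 - α)) := by
  have : (6 : ℝ) - α ≠ 0 := by linarith
  field_simp
  ring


/-! ### The assembly -/

/-- **Assembly (Δ1).** `P1 ∧ P2 ∧ P3 ∧ P4 ∧ P5 → UniformCatalystVolumeTail`, by crossover bookkeeping: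
with `a' = min a 1/2` from P1, take `α := a'/2`; small `b ≤ b₀(α)` by P4; otherwise `p(b) < p_c` (P5) and
`b ≤ log 64`; at scales `n ≤ λ^{−1/(1−α)}` use P2 + P1 (pointwise and summed, `Σ_{k≤n} k^{−a'} ≤ 3 n^{1−a'}`),
at scales `n > λ^{−1/(1−α)}` use P3 (`λ^{−3/(6−α)} < n^{3(1−α)/(6−α)}` and
`(3−α)/6 − 3(1−α)/(6−α) = (9α+α²)/(6(6−α)) > 0`). -/
theorem uniformCatalystVolumeTail_of (h1 : SRSubcritVolumeTail) (h2 : EntropicCatalystInsertion)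
    (h3 : PerLambdaCatalystVolumeTail) (h4 : SmallBetaCatalystTail)
    (h5 : NonPercolatingBelowCritical) : UniformCatalystVolumeTail := by
  classical
  obtain ⟨a, C, ha, hP1⟩ := h1
  -- exponents
  set a' : ℝ := min a (1 / 2) with ha'
  have ha'0 : 0 < a' := lt_min ha (by norm_num)
  have ha'a : a' ≤ a := min_le_left _ _
  have ha'h : a' ≤ 1 / 2 := min_le_right _ _
  set α : ℝ := a' / 2 with hαdef
  have hα0 : 0 < α := by rw [hαdef]; linarith
  have hα3 : α < 3 := by rw [hαdef]; linarith
  have hαa' : α ≤ a' := by rw [hαdef]; linarith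
  have h6 : (0 : ℝ) < 6 - α := by linarith
  set e₃ : ℝ := (9 * α + α ^ 2) / (6 * (6 - α)) with he₃
  have he₃0 : 0 < e₃ := by
    rw [he₃]
    exact div_pos (add_pos (by linarith) (pow_pos hα0 2)) (mul_pos (by norm_num) h6)
  -- constants from the pieces
  obtain ⟨K, hK0, hP2⟩ := h2 α hα0
  obtain ⟨b₀, hb₀, C₄, a₄, ha₄, hP4⟩ := h4 α hα0
  obtain ⟨A, hA0, hP3⟩ := h3 α hα0 hα3 b₀ hb₀
  set Cp : ℝ := max C 0 with hCp
  set C₄p : ℝ := max C₄ 0 with hC₄p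
  have hCp0 : 0 ≤ Cp := le_max_right _ _
  have hC₄p0 : 0 ≤ C₄p := le_max_right _ _
  set L : ℝ := Real.log 64 with hL
  have hL0 : 0 < L := Real.log_pos (by norm_num)
  set CA : ℝ := 2 * Cp + K * L * (3 * Cp) with hCA
  have hCA0 : 0 ≤ CA := by rw [hCA]; positivity
  set afin : ℝ := min a₄ (min α e₃) with hafin
  set Cfin : ℝ := C₄p + CA + A with hCfin
  have hafin0 : 0 < afin := lt_min ha₄ (lt_min hα0 he₃0)
  refine ⟨α, afin, Cfin, hα0, hα3, hafin0, ?_⟩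
  intro l hl hl1 b hb hθ n hn
  -- restate the goal and the non-percolation hypothesis through `catalystLaw` / `clusterSizeGe`
  change (catalystLaw α l b).real (percolatesAt (0 : Site 3)) = 0 at hθ
  change (catalystLaw α l b).real (clusterSizeGe (0 : Site 3) n) ≤ Cfin * (n : ℝ) ^ (-afin)
  have hn0 : (0 : ℝ) < n := by exact_mod_cast hn
  have hn1 : (1 : ℝ) ≤ n := by exact_mod_cast hn
  -- generic last step: `V ≤ C' n^{-a''}` with `C' ≤ Cfin`, `afin ≤ a''` gives the claim
  have final : ∀ (Cpart apart : ℝ), 0 ≤ Cpart → Cpart ≤ Cfin → afin ≤ apart →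
      (catalystLaw α l b).real (clusterSizeGe (0 : Site 3) n) ≤ Cpart * (n : ℝ) ^ (-apart) →
      (catalystLaw α l b).real (clusterSizeGe (0 : Site 3) n) ≤ Cfin * (n : ℝ) ^ (-afin) := by
    intro Cpart apart hC0 hCle hale hbound
    refine hbound.trans ?_
    have hpow : (n : ℝ) ^ (-apart) ≤ (n : ℝ) ^ (-afin) :=
      Real.rpow_le_rpow_of_exponent_le hn1 (by linarith)
    calc Cpart * (n : ℝ) ^ (-apart) ≤ Cpart * (n : ℝ) ^ (-afin) :=
          mul_le_mul_of_nonneg_left hpow hC0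
      _ ≤ Cfin * (n : ℝ) ^ (-afin) :=
          mul_le_mul_of_nonneg_right hCle (Real.rpow_nonneg hn0.le _)
  have hCfin1 : C₄p ≤ Cfin := by rw [hCfin]; linarith
  have hCfin2 : CA ≤ Cfin := by rw [hCfin]; linarith
  have hCfin3 : A ≤ Cfin := by rw [hCfin]; linarith
  rcases le_or_gt b b₀ with hbsmall | hblarge
  · -- regime 0 (small b): P4
    have h0 := hP4 l hl hl1 b hb hbsmall n hn
    refine final C₄p a₄ hC₄p0 hCfin1 (min_le_left _ _) (h0.trans ?_)
    exact mul_le_mul_of_nonneg_right (le_max_left _ _) (Real.rpow_nonneg hn0.le _)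
  · -- b > b₀: the nearest-neighbour density p = 1 - e^{-b} is subcritical (P5) and b ≤ log 64
    have hexp0 : 0 < Real.exp (-b) := Real.exp_pos _
    have hexp1 : Real.exp (-b) < 1 := Real.exp_lt_one_iff.2 (by linarith)
    set pr : ℝ := 1 - Real.exp (-b) with hpr
    have hpr01 : pr ∈ unitInterval := ⟨by rw [hpr]; linarith, by rw [hpr]; linarith⟩
    set p : unitInterval := ⟨pr, hpr01⟩ with hpdef
    have hpcoe : (p : ℝ) = 1 - Real.exp (-b) := rfl
    have hp_lt : (p : ℝ) < criticalProb (zdGraph 3) (0 : Site 3) := by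
      rw [hpcoe]; exact h5 α hα0 l hl hl1 b hb hθ
    have hbL : b ≤ L := by
      have hpc : criticalProb (zdGraph 3) (0 : Site 3) ≤ 63 / 64 := criticalProb_zd_le (by norm_num)
      have h64 : 1 / 64 < Real.exp (-b) := by rw [hpcoe] at hp_lt; linarith
      have hexpb : Real.exp b < 64 := by
        have hprod : Real.exp b * Real.exp (-b) = 1 := by rw [← Real.exp_add]; simp
        nlinarith [Real.exp_pos b]
      exact ((Real.lt_log_iff_exp_lt (by norm_num)).2 hexpb).le
    -- short-range bounds from P1, with exponent a'
    have hSR : ∀ k : ℕ, 1 ≤ k →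
        (bondPercolation (zdGraph 3) p).real (clusterSizeGe (0 : Site 3) k) ≤ Cp * (k : ℝ) ^ (-a') := by
      intro k hk
      have hk1 : (1 : ℝ) ≤ k := by exact_mod_cast hk
      have hk0 : (0 : ℝ) ≤ k := by positivity
      calc (bondPercolation (zdGraph 3) p).real (clusterSizeGe (0 : Site 3) k)
          ≤ C * (k : ℝ) ^ (-a) := hP1 p hp_lt k hk
        _ ≤ Cp * (k : ℝ) ^ (-a) := mul_le_mul_of_nonneg_right (le_max_left _ _) (Real.rpow_nonneg hk0 _)
        _ ≤ Cp * (k : ℝ) ^ (-a') :=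
            mul_le_mul_of_nonneg_left (Real.rpow_le_rpow_of_exponent_le hk1 (by linarith)) hCp0
    have hsum : ∑ k ∈ Finset.Icc 1 n, (bondPercolation (zdGraph 3) p).real (clusterSizeGe (0 : Site 3) k)
        ≤ Cp * (3 * (n : ℝ) ^ (1 - a')) := by
      calc ∑ k ∈ Finset.Icc 1 n, (bondPercolation (zdGraph 3) p).real (clusterSizeGe (0 : Site 3) k)
          ≤ ∑ k ∈ Finset.Icc 1 n, Cp * (k : ℝ) ^ (-a') :=
            Finset.sum_le_sum fun k hk => hSR k (Finset.mem_Icc.1 hk).1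
        _ = Cp * ∑ k ∈ Finset.Icc 1 n, (k : ℝ) ^ (-a') := by rw [← Finset.mul_sum]
        _ ≤ Cp * (3 * (n : ℝ) ^ (1 - a')) :=
            mul_le_mul_of_nonneg_left (sum_Icc_rpow_neg_le ha'0 ha'h n hn) hCp0
    have hsum0 : 0 ≤ ∑ k ∈ Finset.Icc 1 n,
        (bondPercolation (zdGraph 3) p).real (clusterSizeGe (0 : Site 3) k) :=
      Finset.sum_nonneg fun _ _ => measureReal_nonneg
    -- entropic insertion (P2)
    have hE := hP2 l hl hl1 b hb p hpcoe n hn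
    rcases le_or_gt l ((n : ℝ) ^ (-(1 - α))) with hlA | hlB
    · -- regime A: n ≤ l^{-1/(1-α)}
      have hnα : 0 ≤ (n : ℝ) ^ (-α) := Real.rpow_nonneg hn0.le _
      have t1 : 2 * (bondPercolation (zdGraph 3) p).real (clusterSizeGe (0 : Site 3) n) ≤
          2 * Cp * (n : ℝ) ^ (-α) := by
        have hpow : (n : ℝ) ^ (-a') ≤ (n : ℝ) ^ (-α) :=
          Real.rpow_le_rpow_of_exponent_le hn1 (by linarith)
        have := (hSR n hn).trans (mul_le_mul_of_nonneg_left hpow hCp0)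
        linarith
      have t2 : K * b * l * ∑ k ∈ Finset.Icc 1 n,
            (bondPercolation (zdGraph 3) p).real (clusterSizeGe (0 : Site 3) k) ≤
          K * L * (3 * Cp) * (n : ℝ) ^ (-α) := by
        have hbl : b * l ≤ L * (n : ℝ) ^ (-(1 - α)) := mul_le_mul hbL hlA hl.le hL0.le
        have hKbl0 : 0 ≤ K * b * l := by positivity
        have hexpA : -(1 - α) + (1 - a') = -α := by rw [hαdef]; ring
        calc K * b * l * ∑ k ∈ Finset.Icc 1 n,
              (bondPercolation (zdGraph 3) p).real (clusterSizeGe (0 : Site 3) k)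
            ≤ K * b * l * (Cp * (3 * (n : ℝ) ^ (1 - a'))) := mul_le_mul_of_nonneg_left hsum hKbl0
          _ = K * (b * l) * (Cp * (3 * (n : ℝ) ^ (1 - a'))) := by ring
          _ ≤ K * (L * (n : ℝ) ^ (-(1 - α))) * (Cp * (3 * (n : ℝ) ^ (1 - a'))) := by
              apply mul_le_mul_of_nonneg_right _ (by positivity)
              exact mul_le_mul_of_nonneg_left hbl hK0
          _ = K * L * (3 * Cp) * ((n : ℝ) ^ (-(1 - α)) * (n : ℝ) ^ (1 - a')) := by ring
          _ = K * L * (3 * Cp) * (n : ℝ) ^ (-α) := by rw [← Real.rpow_add hn0, hexpA]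
      have hboundA : (catalystLaw α l b).real (clusterSizeGe (0 : Site 3) n) ≤ CA * (n : ℝ) ^ (-α) := by
        calc (catalystLaw α l b).real (clusterSizeGe (0 : Site 3) n) ≤ _ := hE
          _ ≤ 2 * Cp * (n : ℝ) ^ (-α) + K * L * (3 * Cp) * (n : ℝ) ^ (-α) := add_le_add t1 t2
          _ = CA * (n : ℝ) ^ (-α) := by rw [hCA]; ring
      exact final CA α hCA0 hCfin2 ((min_le_right _ _).trans (min_le_left _ _)) hboundA
    · -- regime B: n > l^{-1/(1-α)}: per-λ Hutchcroft (P3)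
      have hP3b := hP3 l hl hl1 b hblarge.le hθ n hn
      have hx0 : 0 < (n : ℝ) ^ (-(1 - α)) := Real.rpow_pos_of_pos hn0 _
      have hs0 : -(3 / (6 - α)) ≤ 0 := by
        have : 0 < 3 / (6 - α) := div_pos (by norm_num) h6
        linarith
      have hls : l ^ (-(3 / (6 - α))) ≤ ((n : ℝ) ^ (-(1 - α))) ^ (-(3 / (6 - α))) :=
        Real.rpow_le_rpow_of_nonpos hx0 hlB.le hs0
      have hns : ((n : ℝ) ^ (-(1 - α))) ^ (-(3 / (6 - α))) = (n : ℝ) ^ ((1 - α) * (3 / (6 - α))) := by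
        rw [← Real.rpow_mul hn0.le]; congr 1; ring
      have hexpB : (1 - α) * (3 / (6 - α)) + -((3 - α) / 6) = -e₃ := by
        rw [he₃]; field_simp; ring
      have hboundB : (catalystLaw α l b).real (clusterSizeGe (0 : Site 3) n) ≤ A * (n : ℝ) ^ (-e₃) := by
        calc (catalystLaw α l b).real (clusterSizeGe (0 : Site 3) n)
            ≤ A * l ^ (-(3 / (6 - α))) * (n : ℝ) ^ (-((3 - α) / 6)) := hP3b
          _ ≤ A * (n : ℝ) ^ ((1 - α) * (3 / (6 - α))) * (n : ℝ) ^ (-((3 - α) / 6)) := by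
              apply mul_le_mul_of_nonneg_right _ (Real.rpow_nonneg hn0.le _)
              exact mul_le_mul_of_nonneg_left (hls.trans hns.le) hA0
          _ = A * ((n : ℝ) ^ ((1 - α) * (3 / (6 - α))) * (n : ℝ) ^ (-((3 - α) / 6))) := by ring
          _ = A * (n : ℝ) ^ (-e₃) := by rw [← Real.rpow_add hn0, hexpB]
      exact final A e₃ hA0 hCfin3 ((min_le_right _ _).trans (min_le_right _ _)) hboundB


/-! ### The converse: `U ∧ SubcritCatalystStability → P1` (monotone coupling; step 1 of the route's Assembly) -/

/-- `Sym2.lift dist ≥ 0`. -/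
theorem lift_dist_nonneg (e : Sym2 (Site 3)) :
    0 ≤ Sym2.lift ⟨fun x y : Site 3 => (dist x y : ℝ), fun x y => dist_comm x y⟩ e := by
  induction e using Sym2.ind with
  | h x y =>
    show (0 : ℝ) ≤ dist x y
    exact dist_nonneg

/-- The nearest-neighbour weights `p·1{e ∈ E(ℤ³)}` are dominated by the catalyst weights once
`p ≤ 1 − e^{−b}` (`J_{λ,α} ≥ 1` on lattice edges). -/
theorem indicator_le_catalystWeight {α l b : ℝ} (hl : 0 ≤ l) (hb : 0 ≤ b) (p : unitInterval)
    (hpb : (p : ℝ) ≤ 1 - Real.exp (-b)) :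
    (fun e : Sym2 (Site 3) => if e ∈ (zdGraph 3).edgeSet then p else 0) ≤
      kernelEdgeProb (catalystKernel l α) b := by
  classical
  intro e
  by_cases he : e ∈ (zdGraph 3).edgeSet
  · simp only [he, if_true]
    have hJ : 1 ≤ catalystKernel l α e := by
      unfold catalystKernel
      rw [if_pos he]
      have : 0 ≤ l * (Sym2.lift ⟨fun x y : Site 3 => (dist x y : ℝ), fun x y => dist_comm x y⟩ e) ^ (-(3 + α)) :=
        mul_nonneg hl (Real.rpow_nonneg (lift_dist_nonneg e) _)
      linarith
    have hval : (p : ℝ) ≤ 1 - Real.exp (-(b * catalystKernel l α e)) := by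
      have hexp : Real.exp (-(b * catalystKernel l α e)) ≤ Real.exp (-b) :=
        Real.exp_le_exp.2 (by nlinarith)
      linarith
    rw [← Subtype.coe_le_coe]
    unfold kernelEdgeProb
    rw [Set.coe_projIcc]
    exact le_max_of_le_right (le_min p.2.2 hval)
  · simp only [he, if_false]
    rw [← Subtype.coe_le_coe]
    exact (kernelEdgeProb (catalystKernel l α) b e).2.1

/-- **Converse.** `UniformCatalystVolumeTail → SubcritCatalystStability → SRSubcritVolumeTail`:
for `p < p_c` pick the non-percolating catalyst model dominating `p` (S') and compare the increasing
event `{|C(0)| ≥ n}` (`prodBernoulli_real_mono_of_isUpperSet`). Together with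
`uniformCatalystVolumeTail_of` this certifies `U ≡ P1` modulo {S', P2, P3, P4, P5}. -/
theorem srSubcritVolumeTail_of (hU : UniformCatalystVolumeTail) (hS : SubcritCatalystStability) :
    SRSubcritVolumeTail := by
  classical
  obtain ⟨α, a, C, hα0, hα3, ha, hUb⟩ := hU
  refine ⟨a, C, ha, fun p hp n hn => ?_⟩
  obtain ⟨b, l, hb, hl, hl1, hpb, hθ⟩ := hS α hα0 p hp
  have hcat := hUb l hl hl1 b hb hθ n hn
  change (catalystLaw α l b).real (clusterSizeGe (0 : Site 3) n) ≤ C * (n : ℝ) ^ (-a) at hcat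
  refine le_trans ?_ hcat
  have hbond : bondPercolation (zdGraph 3) p =
      prodBernoulli (fun e : Sym2 (Site 3) => if e ∈ (zdGraph 3).edgeSet then p else 0) := by
    rw [prodBernoulli_indicator_holds]
    rfl
  rw [hbond]
  change (prodBernoulli _).real _ ≤ (prodBernoulli (kernelEdgeProb (catalystKernel l α) b)).real _
  exact prodBernoulli_real_mono_of_isUpperSet (indicator_le_catalystWeight hl.le hb.le p hpb)
    (isUpperSet_clusterSizeGe 0 n) (measurableSet_clusterSizeGe 0 n)

end Summit.CriticalPhenomena.PercolationContinuityZ3.Cruxes.UniformCatalystVolumeTail.Unmask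

end
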